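import Mathlib
import Literature.Analysis.FluidPDE.VectorCalculus
import Summits.NavierStokesRegularity.NavierStokesRegularity.Theorems.ThreadingFluxErtelTowerLaplacianTools
import Summits.NavierStokesRegularity.NavierStokesRegularity.Theorems.ThreadingFluxErtelTowerStrainShadowSurvivor
import Summits.NavierStokesRegularity.NavierStokesRegularity.Theorems.ThreadingFluxHorizonTowerProfileFormulas
import HarnessLib

/-!
# Crux `PoloidalLiouville` (stmt-NavierStokesRegularity-1222, W1), crux idea «radial-jerk-tower» (ns-idea-15 g7):
# THE STRAIN SHADOW, II — frames off the principal planes, `B = k·B⋆`, and `∇k ∥ x`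

Support file (`--supports stmt-NavierStokesRegularity-1222`, helper).  Experiment cell `ns-wall-extremal`, width hand
ns-wall-eng-5 g6, director KEY-NS #186 («V21 radial-jerk-tower sizes go to eng-5 g6»); critic of record ns-wall-crit-1 g4
(V21 PASS-WITH-PRICE; V21-P2 types `StrainShadowClassificationLocal` as the M rung).  0 kit.

Middle links of the proof chain of `StrainShadowClassificationLocal`, off the principal planes `{xᵢ = 0}` for pairwise distinct
strains `S = diag(a,b,c)`, where `x, Sx, τ = Sx × x` and `τ, Sτ, x` are frames:

* pointwise frames: `norm_sq_topField`, `inner_cross_strain_topField` (`⟪x, Sx × τ⟫ = −‖τ‖²`),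
  `eq_smul_topField` (⊥ `x`, `Sx` ⇒ multiple of `τ`), `inner_topField_cross` (`⟪τ, Sτ × x⟫ = −(b−c)(c−a)(a−b)x₀x₁x₂‖x‖²`),
  `eq_smul_self_of_perp_topField` (⊥ `τ`, `Sτ` ⇒ radial), `topField_ne_zero`, `inner_topField_cross_ne_zero`,
  `strain_smul`, `strain_topField` (`Sτ` is the top field `topField 0 (c(b−a)) (b(c−a))`), `divergence_strain_topField`
  (`div Sτ = 0`), `divergence_congr_nhds`;
* ★ `shadow_exists_coeff` — a jointly smooth field tangent to the spheres and to the `S`-ellipsoids is `k·B⋆`,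
  `B⋆ = exp(xᵀSx/2ν)(Sx × x)` the survivor of `ThreadingFluxErtelTowerStrainShadowSurvivor`, with `k` jointly smooth;
* ★ `shadow_gradient_coeff_radial` — if moreover `div B = 0` and `⟪B,S²x⟫ = ν div(SB)`, then `∇k ∥ x`
  (`∇k ⊥ τ` from `div B⋆ = 0`; `∇k ⊥ Sτ` from `div(exp(q/2ν)Sτ) = exp(q/2ν)⟪Sx,Sτ⟫/ν`).

BOOKING (critic's words, V21-P1/P2/P4): a statement about the LINEAR STRAIN SHADOW of the wall — the passive viscous
equation in the prescribed unbounded drift `Sx` — not about `PoloidalLiouville` ⟨1222⟩ or `UnthreadedRigidity` ⟨27585⟩; helper,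
no rung credit on W1 (movement 0); it refutes nothing.  `PoloidalLiouville` (1222) / (27585) OPEN; NS regularity NOT proved.
-/

-- the summit and its single problem share the name (D-0017 nested layout)
set_option linter.dupNamespace false

noncomputable section

namespace Summit.NavierStokesRegularity.NavierStokesRegularity.Theorems.PoloidalLiouville.ErtelTower

open Set Function Filter Topology Metric
open scoped Topology RealInnerProductSpace InnerProductSpace
open Literature.Analysis.FluidPDE
open Summit.NavierStokesRegularity.NavierStokesRegularity.Theorems.PoloidalLiouville.HorizonTower (E3)

/-! ### Pointwise frames built from `x`, `Sx`, `τ = Sx × x`, `Sτ` -/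

section Frames

variable {a b c : ℝ}

/-- `‖τ‖²` in coordinates. -/
theorem norm_sq_topField (x : E3) :
    ‖topField a b c x‖ ^ 2 = ((b - c) * x 1 * x 2) ^ 2 + ((c - a) * x 2 * x 0) ^ 2 + ((a - b) * x 0 * x 1) ^ 2 := by
  rw [EuclideanSpace.real_norm_sq_eq, Fin.sum_univ_three]
  simp [topField]

/-- `⟪x, Sx × τ⟫ = −‖τ‖²` (`τ = Sx × x`), in coordinates. -/
theorem inner_cross_strain_topField (x : E3) :
    inner ℝ x (cross (strain a b c x) (topField a b c x))
      = -(((b - c) * x 1 * x 2) ^ 2 + ((c - a) * x 2 * x 0) ^ 2 + ((a - b) * x 0 * x 1) ^ 2) := by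
  simp [cross, crossProduct, strain, topField, EuclideanSpace.inner_eq_star_dotProduct, dotProduct, Fin.sum_univ_three]
  ring

/-- **Frame lemma 1**: a vector orthogonal to `x` and to `Sx` is a multiple of `τ = Sx × x` wherever `τ ≠ 0`. -/
theorem eq_smul_topField {w x : E3} (hx : inner ℝ w x = 0) (hS : inner ℝ w (strain a b c x) = 0)
    (hτ : topField a b c x ≠ 0) :
    w = (inner ℝ w (topField a b c x) / ‖topField a b c x‖ ^ 2) • topField a b c x := by
  have hτ2 : ‖topField a b c x‖ ^ 2 ≠ 0 := pow_ne_zero 2 (norm_ne_zero_iff.mpr hτ)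
  have hdet : inner ℝ x (cross (strain a b c x) (topField a b c x)) ≠ 0 := by
    rw [inner_cross_strain_topField, ← norm_sq_topField, neg_ne_zero]; exact hτ2
  have h := eq_zero_of_inner_frame (w := w - (inner ℝ w (topField a b c x) / ‖topField a b c x‖ ^ 2) • topField a b c x)
    (p := x) (q := strain a b c x) (r := topField a b c x) ?_ ?_ ?_ hdet
  · exact sub_eq_zero.mp h
  · rw [inner_sub_left, real_inner_smul_left, hx, topField_tangent, mul_zero, sub_zero]
  · rw [inner_sub_left, real_inner_smul_left, hS, topField_perp_strain, mul_zero, sub_zero]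
  · rw [inner_sub_left, real_inner_smul_left, real_inner_self_eq_norm_sq, div_mul_cancel₀ _ hτ2, sub_self]

/-- `⟪τ, Sτ × x⟫ = −(b − c)(c − a)(a − b)·x₀x₁x₂·‖x‖²`, in coordinates. -/
theorem inner_topField_cross (x : E3) :
    inner ℝ (topField a b c x) (cross (strain a b c (topField a b c x)) x)
      = -((b - c) * (c - a) * (a - b)) * (x 0 * x 1 * x 2) * (x 0 ^ 2 + x 1 ^ 2 + x 2 ^ 2) := by
  simp [cross, crossProduct, strain, topField, EuclideanSpace.inner_eq_star_dotProduct, dotProduct, Fin.sum_univ_three]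
  ring

/-- **Frame lemma 2**: a vector orthogonal to `τ` and to `Sτ` is radial wherever `⟪τ, Sτ × x⟫ ≠ 0` (off the principal
planes, for pairwise distinct strains). -/
theorem eq_smul_self_of_perp_topField {w x : E3} (h1 : inner ℝ w (topField a b c x) = 0)
    (h2 : inner ℝ w (strain a b c (topField a b c x)) = 0)
    (hdet : inner ℝ (topField a b c x) (cross (strain a b c (topField a b c x)) x) ≠ 0) :
    w = (inner ℝ w x / ‖x‖ ^ 2) • x := by
  have hx0 : x ≠ 0 := by
    rintro rfl
    apply hdet
    simp [cross, crossProduct, EuclideanSpace.inner_eq_star_dotProduct, dotProduct, Fin.sum_univ_three]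
  have hx2 : ‖x‖ ^ 2 ≠ 0 := pow_ne_zero 2 (norm_ne_zero_iff.mpr hx0)
  have h := eq_zero_of_inner_frame (w := w - (inner ℝ w x / ‖x‖ ^ 2) • x)
    (p := topField a b c x) (q := strain a b c (topField a b c x)) (r := x) ?_ ?_ ?_ hdet
  · exact sub_eq_zero.mp h
  · rw [inner_sub_left, real_inner_smul_left, h1, real_inner_comm (topField a b c x) x, topField_tangent, mul_zero,
      sub_zero]
  · rw [inner_sub_left, real_inner_smul_left, h2, ← inner_strain_comm a b c x (topField a b c x),
      real_inner_comm (topField a b c x) (strain a b c x), topField_perp_strain, mul_zero, sub_zero]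
  · rw [inner_sub_left, real_inner_smul_left, real_inner_self_eq_norm_sq, div_mul_cancel₀ _ hx2, sub_self]

/-- Off the principal planes, for pairwise distinct strains, `τ ≠ 0`. -/
theorem topField_ne_zero (hbc : b ≠ c) {x : E3} (hx : x 0 ≠ 0 ∧ x 1 ≠ 0 ∧ x 2 ≠ 0) : topField a b c x ≠ 0 := by
  intro h
  have h0 : topField a b c x 0 = 0 := by rw [h]; rfl
  rw [(topField_apply a b c x).1] at h0
  rcases mul_eq_zero.mp h0 with h01 | h2
  · rcases mul_eq_zero.mp h01 with hbc' | h1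
    · exact hbc (sub_eq_zero.mp hbc')
    · exact hx.2.1 h1
  · exact hx.2.2 h2

/-- Off the principal planes, for pairwise distinct strains, the frame determinant `⟪τ, Sτ × x⟫ ≠ 0`. -/
theorem inner_topField_cross_ne_zero (hab : a ≠ b) (hbc : b ≠ c) (hca : c ≠ a) {x : E3}
    (hx : x 0 ≠ 0 ∧ x 1 ≠ 0 ∧ x 2 ≠ 0) :
    inner ℝ (topField a b c x) (cross (strain a b c (topField a b c x)) x) ≠ 0 := by
  rw [inner_topField_cross]
  have hx0 : 0 < x 0 ^ 2 := by have := hx.1; positivity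
  have : x 0 ^ 2 + x 1 ^ 2 + x 2 ^ 2 ≠ 0 := by nlinarith [sq_nonneg (x 1), sq_nonneg (x 2)]
  have h1 : (b - c) * (c - a) * (a - b) ≠ 0 :=
    mul_ne_zero (mul_ne_zero (sub_ne_zero.mpr hbc) (sub_ne_zero.mpr hca)) (sub_ne_zero.mpr hab)
  have h2 : x 0 * x 1 * x 2 ≠ 0 := mul_ne_zero (mul_ne_zero hx.1 hx.2.1) hx.2.2
  exact mul_ne_zero (mul_ne_zero (neg_ne_zero.mpr h1) h2) this

/-- `⟪τ, S²x⟫ = −(a−b)(b−c)(c−a)·x₀x₁x₂` in the tree's `strain ∘ strain` spelling. -/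
theorem topField_dot_strain_strain (x : E3) :
    inner ℝ (topField a b c x) (strain a b c (strain a b c x)) = -((a - b) * (b - c) * (c - a)) * (x 0 * x 1 * x 2) := by
  rw [strain_strain]; exact topField_dot_strainSq a b c x

/-- The strain drift is linear: `S(r • v) = r • S v`. -/
theorem strain_smul (r : ℝ) (v : E3) : strain a b c (r • v) = r • strain a b c v := by
  ext i
  fin_cases i <;> simp [strain] <;> ring

/-- `Sτ` is again an Euler-top field: `S(Sx × x) = topField 0 (c(b−a)) (b(c−a))` (its parameters sum with the right
signs because `a(b−c) + b(c−a) + c(a−b) = 0`). -/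
theorem strain_topField (y : E3) : strain a b c (topField a b c y) = topField 0 (c * (b - a)) (b * (c - a)) y := by
  ext i
  fin_cases i <;> simp [strain, topField] <;> ring

/-- `div (Sτ) = 0`. -/
theorem divergence_strain_topField (x : E3) :
    Literature.Analysis.FluidPDE.VectorCalculus.divergence (fun y => strain a b c (topField a b c y)) x = 0 := by
  have h : (fun y => strain a b c (topField a b c y)) = topField 0 (c * (b - a)) (b * (c - a)) :=
    funext fun y => strain_topField y
  rw [h]
  exact divergence_topField 0 (c * (b - a)) (b * (c - a)) x

/-- The divergence is local. -/
theorem divergence_congr_nhds {f g : E3 → E3} {x : E3} (h : f =ᶠ[𝓝 x] g) :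
    Literature.Analysis.FluidPDE.VectorCalculus.divergence f x
      = Literature.Analysis.FluidPDE.VectorCalculus.divergence g x := by
  unfold Literature.Analysis.FluidPDE.VectorCalculus.divergence
  rw [h.fderiv_eq]

end Frames

/-! ### The strain shadow off the principal planes: `B = k · B⋆` and `∇k ∥ x` -/

section ShadowFrame

variable {ν a b c : ℝ} {B : ℝ → E3 → E3} {k : ℝ → E3 → ℝ} {I : Set ℝ} {U : Set E3}

/-- **`B = k · B⋆`**: a jointly smooth field that is tangent to the spheres and to the `S`-ellipsoids on an open `I × U`
off the principal planes is a smooth multiple of the survivor `B⋆ = exp(xᵀSx/2ν)·(Sx × x)`. -/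
theorem shadow_exists_coeff (hbc : b ≠ c) (hoff : U ⊆ {x | x 0 ≠ 0 ∧ x 1 ≠ 0 ∧ x 2 ≠ 0})
    (hB : ContDiffOn ℝ (⊤ : ℕ∞) (Function.uncurry B) (I ×ˢ U))
    (htan : ∀ t ∈ I, ∀ x ∈ U, inner ℝ (B t x) x = 0)
    (hS : ∀ t ∈ I, ∀ x ∈ U, inner ℝ (B t x) (strain a b c x) = 0) :
    ∃ k : ℝ → E3 → ℝ, ContDiffOn ℝ (⊤ : ℕ∞) (Function.uncurry k) (I ×ˢ U) ∧
      ∀ t ∈ I, ∀ x ∈ U, B t x = k t x • (Real.exp (quadForm a b c x / (2 * ν)) • topField a b c x) := by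
  refine ⟨fun t x => inner ℝ (B t x) (topField a b c x)
      / (‖topField a b c x‖ ^ 2 * Real.exp (quadForm a b c x / (2 * ν))), ?_, ?_⟩
  · have hnum : ContDiffOn ℝ (⊤ : ℕ∞) (fun q : ℝ × E3 => inner ℝ (Function.uncurry B q) (topField a b c q.2)) (I ×ˢ U) :=
      hB.inner ℝ ((contDiff_topField a b c).comp contDiff_snd).contDiffOn
    have hden : ContDiffOn ℝ (⊤ : ℕ∞)
        (fun q : ℝ × E3 => ‖topField a b c q.2‖ ^ 2 * Real.exp (quadForm a b c q.2 / (2 * ν))) (I ×ˢ U) := by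
      have h1 : ContDiff ℝ (⊤ : ℕ∞) (fun q : ℝ × E3 => ‖topField a b c q.2‖ ^ 2) :=
        ((contDiff_topField a b c).comp contDiff_snd).norm_sq ℝ
      have h2 : ContDiff ℝ (⊤ : ℕ∞) (fun q : ℝ × E3 => Real.exp (quadForm a b c q.2 / (2 * ν))) :=
        (contDiff_sigma ν a b c).comp contDiff_snd
      exact (h1.mul h2).contDiffOn
    refine (hnum.div hden ?_).congr ?_
    · rintro ⟨t, x⟩ ⟨-, hx⟩
      exact mul_ne_zero (pow_ne_zero 2 (norm_ne_zero_iff.mpr (topField_ne_zero hbc (hoff hx)))) (Real.exp_pos _).ne'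
    · rintro ⟨t, x⟩ _; rfl
  · intro t ht x hx
    have hτ : topField a b c x ≠ 0 := topField_ne_zero hbc (hoff hx)
    have hτ2 : ‖topField a b c x‖ ^ 2 ≠ 0 := pow_ne_zero 2 (norm_ne_zero_iff.mpr hτ)
    have hE : Real.exp (quadForm a b c x / (2 * ν)) ≠ 0 := (Real.exp_pos _).ne'
    have h := eq_smul_topField (htan t ht x hx) (hS t ht x hx) hτ
    rw [smul_smul]
    conv_lhs => rw [h]
    congr 1
    field_simp

/-- **`∇k ∥ x`**: if `B = k · B⋆` on the open `I × U` off the principal planes (pairwise distinct trace-free strains) is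
divergence-free and satisfies the level-2 identity `⟪B, S²x⟫ = ν div(SB)`, then the space gradient of `k` is radial:
`∇k ⊥ τ` from `div B = 0` (`div B⋆ = 0`) and `∇k ⊥ Sτ` from the level-2 identity (`div(exp(q/2ν) Sτ) = exp(q/2ν)⟪Sx,Sτ⟫/ν`). -/
theorem shadow_gradient_coeff_radial (hν : 0 < ν) (hab : a ≠ b) (hbc : b ≠ c) (hca : c ≠ a) (htr : a + b + c = 0)
    (hU : IsOpen U) (hoff : U ⊆ {x | x 0 ≠ 0 ∧ x 1 ≠ 0 ∧ x 2 ≠ 0})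
    (hk : ContDiffOn ℝ (⊤ : ℕ∞) (Function.uncurry k) (I ×ˢ U))
    (hBk : ∀ t ∈ I, ∀ x ∈ U, B t x = k t x • (Real.exp (quadForm a b c x / (2 * ν)) • topField a b c x))
    (hdiv : ∀ t ∈ I, ∀ x ∈ U, Literature.Analysis.FluidPDE.VectorCalculus.divergence (B t) x = 0)
    (hsq : ∀ t ∈ I, ∀ x ∈ U, inner ℝ (B t x) (strain a b c (strain a b c x))
      = ν * Literature.Analysis.FluidPDE.VectorCalculus.divergence (fun z => strain a b c (B t z)) x) :
    ∀ t ∈ I, ∀ x ∈ U, gradient (k t) x = (inner ℝ (gradient (k t) x) x / ‖x‖ ^ 2) • x := by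
  intro t ht x hx
  have hν0 : ν ≠ 0 := hν.ne'
  set E : E3 → ℝ := fun y => Real.exp (quadForm a b c y / (2 * ν)) with hEdef
  have hEpos : 0 < E x := Real.exp_pos _
  have hsurv := strainShadowSurvivor ν a b c hν htr
  obtain ⟨-, hdivBs, -, -⟩ := hsurv
  have hktU : ContDiffOn ℝ (⊤ : ℕ∞) (k t) U := contDiffOn_slice hk ht
  have hkd : DifferentiableAt ℝ (k t) x := (hktU.differentiableOn (by simp)).differentiableAt (hU.mem_nhds hx)
  have hBsd : DifferentiableAt ℝ (fun y : E3 => E y • topField a b c y) x :=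
    (contDiff_survivor ν a b c (n := 1)).differentiable (by simp) x
  have hEd : DifferentiableAt ℝ E x := (contDiff_sigma ν a b c (n := 1)).differentiable (by simp) x
  -- (1) `div B = 0` ⇒ `Dk[τ] = 0`
  have hev : B t =ᶠ[𝓝 x] fun z => k t z • (E z • topField a b c z) := by
    filter_upwards [hU.mem_nhds hx] with z hz using hBk t ht z hz
  have h1 : fderiv ℝ (k t) x (topField a b c x) = 0 := by
    have h := hdiv t ht x hx
    rw [divergence_congr_nhds hev, HorizonTower.divergence_smul_apply hkd hBsd, hdivBs x, mul_zero, zero_add, map_smul,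
      smul_eq_mul] at h
    exact (mul_eq_zero.mp h).resolve_left hEpos.ne'
  -- (2) the level-2 identity ⇒ `Dk[Sτ] = 0`
  have hSτd : DifferentiableAt ℝ (fun y : E3 => E y • strain a b c (topField a b c y)) x := by
    have h : ContDiff ℝ (⊤ : ℕ∞) (fun y : E3 => strain a b c (topField a b c y)) := by
      have : (fun y : E3 => strain a b c (topField a b c y)) = topField 0 (c * (b - a)) (b * (c - a)) :=
        funext fun y => strain_topField y
      rw [this]; exact contDiff_topField _ _ _
    exact hEd.smul (h.differentiable (by simp) x)
  have hevS : (fun z => strain a b c (B t z)) =ᶠ[𝓝 x] fun z => k t z • (E z • strain a b c (topField a b c z)) := by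
    filter_upwards [hU.mem_nhds hx] with z hz
    rw [hBk t ht z hz, strain_smul, strain_smul]
  have hdivES : Literature.Analysis.FluidPDE.VectorCalculus.divergence (fun y : E3 => E y • strain a b c (topField a b c y)) x
      = E x * (inner ℝ (strain a b c x) (strain a b c (topField a b c x)) / ν) := by
    have hSd : DifferentiableAt ℝ (fun y : E3 => strain a b c (topField a b c y)) x := by
      have : (fun y : E3 => strain a b c (topField a b c y)) = topField 0 (c * (b - a)) (b * (c - a)) :=
        funext fun y => strain_topField y
      rw [this]; exact (contDiff_topField _ _ _ (n := 1)).differentiable (by simp) x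
    rw [HorizonTower.divergence_smul_apply hEd hSd, divergence_strain_topField, mul_zero, zero_add, hEdef,
      fderiv_sigma_apply ν a b c hν0]
  have h2 : fderiv ℝ (k t) x (strain a b c (topField a b c x)) = 0 := by
    have h := hsq t ht x hx
    rw [divergence_congr_nhds hevS, HorizonTower.divergence_smul_apply hkd hSτd, hdivES, hBk t ht x hx, map_smul, smul_eq_mul,
      inner_smul_left, inner_smul_left] at h
    simp only [conj_trivial] at h
    -- `⟪τ, S(Sx)⟫ = ⟪Sτ, Sx⟫ = ⟪Sx, Sτ⟫`
    rw [← inner_strain_comm (a := a) (b := b) (c := c) (topField a b c x) (strain a b c x),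
      real_inner_comm (strain a b c x)] at h
    have hE0 : E x ≠ 0 := hEpos.ne'
    have : ν * (E x * fderiv ℝ (k t) x (strain a b c (topField a b c x))) = 0 := by
      have h' := h
      field_simp at h'
      nlinarith [h']
    rcases mul_eq_zero.mp this with h0 | h0
    · exact absurd h0 hν0
    · exact (mul_eq_zero.mp h0).resolve_left hE0
  -- (3) the frame lemma
  have hdet := inner_topField_cross_ne_zero hab hbc hca (hoff hx)
  refine eq_smul_self_of_perp_topField ?_ ?_ hdet
  · rw [Literature.Analysis.FluidPDE.inner_gradient_left]; exact h1
  · rw [Literature.Analysis.FluidPDE.inner_gradient_left]; exact h2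

end ShadowFrame

end Summit.NavierStokesRegularity.NavierStokesRegularity.Theorems.PoloidalLiouville.ErtelTower
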